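import Summits.HodgeConjecture.HodgeConjecture.Theorems.HodgeLocusCensusCubicCertStackTwo
import Summits.HodgeConjecture.HodgeConjecture.Theorems.HodgeLocusCensusCubicCertStackStd
import Summits.HodgeConjecture.HodgeConjecture.Theorems.HodgeLocusCensusTwoBlockRows
import Literature.AlgebraicGeometry.Kloosterman2023.CompleteIntersectionHodgeLoci
import HarnessLib

/-!
# HodgeLocusCensusCubicStackedRows — the first-order EXCESS of the (8,3,2) Conjecture-5 pairs as kernel facts: rank [M_{P0} ; M_{Ptwo}] = rank [M_{P0} ; M_{P̌₂}] = 19 = intdim³₈(2) (cell pub-hlocus, LEAD seat ivhs-1, gen 6, (T42))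
HONEST FRAMING: certified instances and evidence bearing on the general Hodge conjecture; no claim.

`HodgeLocusCensusTwoBlockRows` (engine-B seat) proved rank [p_{i+j}]([P0] + [Ptwo]) = 17 and rank [p_{i+j}]([P0] + [P̌₂]) = 16 on the Fermat cubic
8-fold and refuted Movasati's Conjecture 5 at (n,d,m) = (8,3,2). The SECOND number of each census row — the codimension of the intersection of the two
Zariski tangent spaces T NL(P0) ∩ T NL(P) at the Fermat point, i.e. the rank of the STACKED matrix [M_{P0} ; M_P] — is typed here for both pairs from
the dense stacked certificates `stackTwoCert` / `stackStdCert` (`HodgeLocusCensusDenseStack8` format, kernel-checked): it is 19 for BOTH pairs, and 19 is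
also the value of Movasati's closed formula `intdim 8 3 3` [cite: Movasati2016Periods, §6 Thm. 13] (`Literature…Kloosterman2023.intdim`, evaluated by
`decide`). Hence the first-order excess e := rank [M_{P0} ; M_P] − rank M_{[P0]+[P]} is 2 for the two-block pair and 3 for Movasati's standard pair
(`twoBlock_rank_add_two_eq_stackRank_8_3`, `std_rank_add_three_eq_stackRank_8_3`): the two pairs, both meeting in a ℙ², have the SAME tangent-space
intersection dimension and DIFFERENT Hodge-locus tangent dimensions — the typed form of the cell's observation that only the rank entry of the five-tuple
(8,3,2 | 16, 19) depends on the pair (COMPONENTS (T41)/(T42); engines A and B computed 17 / 19 and 16 / 19 numerically first, TWOBLOCK-TOWER-g9.md).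
Class links for the one-plane lists `p0L`, `ptwoL`, `pstdL` come from the per-plane period identities of `HodgeLocusCensusTwoBlockRows`.
-/

namespace Summit.HodgeConjecture.HodgeConjecture.HodgeLocus.Census.CubicTwoBlockStack

open DenseCert8 PlaneSum CubicSum
open Literature.AlgebraicGeometry.Kloosterman2023 (intdim)

section links

variable {K : Type*} [Field K] (ζ : K)

/-- class [P0] ↔ list `p0L`. -/
theorem periodComb_p0 (h2 : ζ ^ 2 = ζ - 1) (i : Fin 10 → ℕ) :
    periodComb 8 3 ζ [(1, standardP 8)] i = Z6.eval ζ (entry p0L (ext i)) := by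
  have e0 := period_standardP8 ζ h2 i
  unfold periodComb
  simp only [List.map, List.sum_cons, List.sum_nil, p0L, eval_entry_cons, eval_entry_nil, e0]
  push_cast; ring

/-- class [Ptwo] ↔ list `ptwoL`. -/
theorem periodComb_ptwo (h2 : ζ ^ 2 = ζ - 1) (i : Fin 10 → ℕ) :
    periodComb 8 3 ζ [(1, twoBlockP8)] i = Z6.eval ζ (entry ptwoL (ext i)) := by
  have e0 := period_twoBlockP8 ζ h2 i
  unfold periodComb
  simp only [List.map, List.sum_cons, List.sum_nil, ptwoL, eval_entry_cons, eval_entry_nil, e0]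
  push_cast; ring

/-- class [P̌₂] ↔ list `pstdL`. -/
theorem periodComb_pstd (h2 : ζ ^ 2 = ζ - 1) (i : Fin 10 → ℕ) :
    periodComb 8 3 ζ [(1, standardPc 8 2 1)] i = Z6.eval ζ (entry pstdL (ext i)) := by
  have e0 := period_standardPc8 ζ h2 i
  unfold periodComb
  simp only [List.map, List.sum_cons, List.sum_nil, pstdL, eval_entry_cons, eval_entry_nil, e0]
  push_cast; ring

end links

/-! ## The stacked rows -/

/-- (8,3 | two-block pair, m = 2): rank [M_{P0} ; M_{Ptwo}] = 19 over every characteristic-0 field with a primitive 6th root of unity — the two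
Zariski tangent spaces T NL(P0), T NL(Ptwo) (codimension 10 each) meet in codimension 19 at the Fermat point. -/
theorem stackRank_8_3_std_twoBlock : ∀ (K : Type) [Field K] [CharZero K] (ζ : K), IsPrimitiveRoot ζ (2 * 3) →
    (Matrix.fromRows (ivhsMatrix 8 3 ζ [(1, standardP 8)]) (ivhsMatrix 8 3 ζ [(1, twoBlockP8)])).rank = 19 :=
  stackRank_of_cert p0L ptwoL _ _ (fun _ _ ζ h2 i => periodComb_p0 ζ h2 i) (fun _ _ ζ h2 i => periodComb_ptwo ζ h2 i)
    stackTwoCert stackTwo_validS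

/-- (8,3 | Movasati's standard pair, m = 2): rank [M_{P0} ; M_{P̌₂}] = 19 as well (P̌₂ = `standardPc 8 2 1`). -/
theorem stackRank_8_3_std_stdTwist : ∀ (K : Type) [Field K] [CharZero K] (ζ : K), IsPrimitiveRoot ζ (2 * 3) →
    (Matrix.fromRows (ivhsMatrix 8 3 ζ [(1, standardP 8)]) (ivhsMatrix 8 3 ζ [(1, standardPc 8 2 1)])).rank = 19 :=
  stackRank_of_cert p0L pstdL _ _ (fun _ _ ζ h2 i => periodComb_p0 ζ h2 i) (fun _ _ ζ h2 i => periodComb_pstd ζ h2 i)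
    stackStdCert stackStd_validS

/-- Movasati's closed formula [cite: Movasati2016Periods, §6 Thm. 13] at (n,d,m+1) = (8,3,3): intdim³₈(2) = 19 — the same number, now for a cubic
(the nine printed five-tuples of §6 are all quartic or higher degree; this value is an evaluation of the printed formula, typed in
`Literature…Kloosterman2023.intdim`). -/
theorem intdim_8_3_2 : intdim 8 3 3 = 19 := by
  decide

/-- both stacked ranks equal the formula value. -/
theorem stackRank_8_3_eq_intdim : ∀ (K : Type) [Field K] [CharZero K] (ζ : K), IsPrimitiveRoot ζ (2 * 3) →
    ((Matrix.fromRows (ivhsMatrix 8 3 ζ [(1, standardP 8)]) (ivhsMatrix 8 3 ζ [(1, twoBlockP8)])).rank : ℤ) = intdim 8 3 3 ∧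
      ((Matrix.fromRows (ivhsMatrix 8 3 ζ [(1, standardP 8)]) (ivhsMatrix 8 3 ζ [(1, standardPc 8 2 1)])).rank : ℤ) = intdim 8 3 3 := by
  intro K _ _ ζ hζ
  rw [stackRank_8_3_std_twoBlock K ζ hζ, stackRank_8_3_std_stdTwist K ζ hζ, intdim_8_3_2]
  exact ⟨rfl, rfl⟩

/-! ## First-order excess: 2 for the two-block pair, 3 for the standard pair -/

/-- TWO-BLOCK pair: rank M_{[P0]+[Ptwo]} + 2 = rank [M_{P0} ; M_{Ptwo}] (17 + 2 = 19): the Zariski tangent space of the Hodge locus of [P0] + [Ptwo]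
at the Fermat point has codimension 17, two less than the intersection T NL(P0) ∩ T NL(Ptwo) — first-order excess e = 2. -/
theorem twoBlock_rank_add_two_eq_stackRank_8_3 : ∀ (K : Type) [Field K] [CharZero K] (ζ : K), IsPrimitiveRoot ζ (2 * 3) →
    (ivhsMatrix 8 3 ζ [(1, standardP 8), (1, twoBlockP8)]).rank + 2 =
      (Matrix.fromRows (ivhsMatrix 8 3 ζ [(1, standardP 8)]) (ivhsMatrix 8 3 ζ [(1, twoBlockP8)])).rank := by
  intro K _ _ ζ hζ
  rw [ivhsRankEq_twoSum K ζ hζ, stackRank_8_3_std_twoBlock K ζ hζ]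

/-- STANDARD pair: rank M_{[P0]+[P̌₂]} + 3 = rank [M_{P0} ; M_{P̌₂}] (16 + 3 = 19): first-order excess e = 3 = n/2 − 1, Movasati's value for his pairs. -/
theorem std_rank_add_three_eq_stackRank_8_3 : ∀ (K : Type) [Field K] [CharZero K] (ζ : K), IsPrimitiveRoot ζ (2 * 3) →
    (ivhsMatrix 8 3 ζ [(1, standardP 8), (1, standardPc 8 2 1)]).rank + 3 =
      (Matrix.fromRows (ivhsMatrix 8 3 ζ [(1, standardP 8)]) (ivhsMatrix 8 3 ζ [(1, standardPc 8 2 1)])).rank := by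
  intro K _ _ ζ hζ
  rw [ivhsRankEq_stdSum K ζ hζ, stackRank_8_3_std_stdTwist K ζ hζ]

/-- the two pairs side by side: equal tangent-space intersections, Hodge-locus tangent codimensions differing by one (the excess drops from 3 to 2
when both coordinate 4-blocks are re-matched). -/
theorem stackRank_eq_and_rank_succ : ∀ (K : Type) [Field K] [CharZero K] (ζ : K), IsPrimitiveRoot ζ (2 * 3) →
    (Matrix.fromRows (ivhsMatrix 8 3 ζ [(1, standardP 8)]) (ivhsMatrix 8 3 ζ [(1, twoBlockP8)])).rank =
        (Matrix.fromRows (ivhsMatrix 8 3 ζ [(1, standardP 8)]) (ivhsMatrix 8 3 ζ [(1, standardPc 8 2 1)])).rank ∧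
      (ivhsMatrix 8 3 ζ [(1, standardP 8), (1, twoBlockP8)]).rank =
        (ivhsMatrix 8 3 ζ [(1, standardP 8), (1, standardPc 8 2 1)]).rank + 1 := by
  intro K _ _ ζ hζ
  refine ⟨?_, twoBlock_rank_eq_std_rank_add_one K ζ hζ⟩
  rw [stackRank_8_3_std_twoBlock K ζ hζ, stackRank_8_3_std_stdTwist K ζ hζ]

end Summit.HodgeConjecture.HodgeConjecture.HodgeLocus.Census.CubicTwoBlockStack
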